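import Summits.Ventures.Crystal3D.Theorems.StickyWulffConstantGenericWallFloorCapStartBarlowStep
import Summits.Ventures.Crystal3D.Theorems.StickyWulffConstantGenericWallFloorBarlowReach
import HarnessLib

/-!
# The PREFIX LEMMA for cap-started walkers on a Barlow plate: inside the complete region the walker runs up its own
# zigzag, state by state (crux `GenericWallFloor`, stmt-Ventures-19480, line `WallLedgerG`; lane T's flux family, E3′)

HONEST FRAMING. Venture `Summits/Ventures/Crystal3D` (cell `crystal3d-full`), helper `--supports` the crux `GenericWallFloor`
(stmt-Ventures-19480) of `route-Ventures-StickyWulffConstant`, registered line `WallLedgerG`, open stub `stub_twoSlabAdhesion`.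
Rung credit only; F-C1 not moved; NOT the stub.  Offered in the F4 interface answer to lane T (INBOX 2026-08-28T15:08:09Z,
(2)(iii) E3′): on a two-rise plate the exit criterion `walkRun_injOn_of_exit` does not apply to a one-start-per-line family;
orbit-freeness must come from the LINE STRUCTURE of the walks, i.e. from this prefix lemma.

THE CANONICAL STATES.  Moved Barlow plate `p ↦ L p + s₀` of the word `σ` (Hägg), per-top frames `L` (Δ) and
`G = twinFrame L (L e₃)` (∇), family slot `v₀` (an upper slot, `v₀ ₂ = √(2/3)`), ∇-step slot `q = bestCapper G (L e₃) z`
(a lower slot of the model frame: `bestCapper_nabla_slot`).  The CANONICAL STATE at a ball `t` of layer `m` is the 1-level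
state `(t, [⟨L, v₀, 0⟩])` if the bilayer below is Δ (`σ(m−1) = 1`) and the 2-level state `(t, [⟨G, q, L e₃⟩, ⟨L, v₀, 0⟩])` if it
is ∇ (`σ(m−1) = −1`) — exactly the CAP-START states of `…CapStartBarlow`; the MODEL STEP of layer `m` is `v₀` (`σ m = 1`) or
`basalMirror q` (`σ m = −1`), after the motion `L v₀` resp. `G q`.  Both are taken as parameters with their defining equations
(`hcanon₁/₂`, `hms₁/₂`) so that statements stay short.

* `bestCapper_nabla_slot` — `q ∈ fccSlots`, `q ₂ = −√(2/3)`;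
* `walkStep_canon` — ONE STEP: if the dozen of the site `(m, i, j)` is complete in `X`, the walk maps the canonical state at
  `L·barlowPos σ m i j + s₀` to the canonical state at the next zigzag site `L·(barlowPos σ m i j + ms m) + s₀`, which is a site
  of layer `m + 1` (the four cases `cc/ch/hh/hc` of `…CapStartBarlowStep`);
* **`walkRun_canon_prefix`** — THE PREFIX: if the first `n` zigzag sites `barlowPos σ m i j + Σ_{k'<k} ms (m+k')` (`k < n`) lie
  in a region `R` of model space over which the moved plate is complete in `X` (`hR`), then
  `walkRun X z n (canonical state at site 0) = canonical state at site n`, and site `n` is a site of layer `m + n`.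
Consequences (next file / lane T glue): two walkers of the family never share a state while inside the plate unless they share
a zigzag; after leaving `R` upward their `z`-heights exceed every start (`walkRun_height_ge`) — orbit-freeness without the
exit criterion.

WHAT THIS IS NOT: no count, no sealing, nothing about the filling above the plate; F-C1 not moved.
-/

noncomputable section

namespace Summit.Ventures.Crystal3D.Theorems

open Finset
open Literature.MathematicalPhysics.StatisticalMechanics
open scoped InnerProductSpace

variable {X : Finset (EuclideanSpace ℝ (Fin 3))}

/-- The basal mirror flips the third coordinate (local copy of `…CapStartBarlow`'s private lemma). -/
private theorem basalMirror_apply_two' (w : EuclideanSpace ℝ (Fin 3)) : basalMirror w 2 = -w 2 := by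
  rw [basalMirror_apply_coord]; simp

/-- A point of layer `m` has third coordinate `m·√(2/3)`. -/
theorem apply_two_of_mem_barlowLayer {σ : ℤ → ℤ} {m : ℤ} {x : EuclideanSpace ℝ (Fin 3)}
    (hx : x ∈ barlowLayer 1 (Real.sqrt (2 / 3)) σ m) : x 2 = m * Real.sqrt (2 / 3) := by
  obtain ⟨i, j, rfl⟩ := hx
  rw [barlowPos_apply_two]

/-- **The ∇-step slot.**  For any frame `L` and vertical `z`, `q = bestCapper G (L e₃) z` with `G = twinFrame L (L e₃)` is a slot
of the model frame with `q ₂ = −√(2/3)` (so `G q = L (basalMirror q)` rises by one layer spacing along the plate axis). -/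
theorem bestCapper_nabla_slot (L : EuclideanSpace ℝ (Fin 3) ≃ₗᵢ[ℝ] EuclideanSpace ℝ (Fin 3)) (z : EuclideanSpace ℝ (Fin 3)) :
    bestCapper (twinFrame L (L (EuclideanSpace.single (2 : Fin 3) (1 : ℝ)))) (L (EuclideanSpace.single (2 : Fin 3) (1 : ℝ))) z
        ∈ fccSlots ∧
      (bestCapper (twinFrame L (L (EuclideanSpace.single (2 : Fin 3) (1 : ℝ)))) (L (EuclideanSpace.single (2 : Fin 3) (1 : ℝ))) z) 2 =
        -Real.sqrt (2 / 3) := by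
  set G := twinFrame L (L (EuclideanSpace.single (2 : Fin 3) (1 : ℝ))) with hG
  have hrpos : 0 < Real.sqrt (2 / 3) := Real.sqrt_pos.2 (by norm_num)
  have hinner : ∀ w : EuclideanSpace ℝ (Fin 3), ⟪G w, L (EuclideanSpace.single (2 : Fin 3) (1 : ℝ))⟫_ℝ = -w 2 := by
    intro w; rw [hG, twinFrame_axis_apply, inner_frame_axis, basalMirror_apply_two']
  have hne : (fccSlots.filter fun q => 0 < ⟪G q, L (EuclideanSpace.single (2 : Fin 3) (1 : ℝ))⟫_ℝ).Nonempty := by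
    refine ⟨-barlowPos 1 (Real.sqrt (2 / 3)) constHagg 1 0 0, Finset.mem_filter.2 ⟨neg_mem_fccSlots upSlot_mem_fccSlots, ?_⟩⟩
    rw [hinner]
    simp only [PiLp.neg_apply, barlowPos_apply_two, neg_neg]
    push_cast; rw [one_mul]; exact hrpos
  obtain ⟨hmem, -⟩ := bestCapper_spec G (L (EuclideanSpace.single (2 : Fin 3) (1 : ℝ))) z hne
  obtain ⟨hq, hpos⟩ := Finset.mem_filter.1 hmem
  refine ⟨hq, ?_⟩
  rw [hinner] at hpos
  rcases slot_apply_two_cases hq with h | h | h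
  · rw [h] at hpos; linarith
  · rw [h] at hpos; linarith
  · exact h

section Moved

variable (σ : ℤ → ℤ) (L : EuclideanSpace ℝ (Fin 3) ≃ₗᵢ[ℝ] EuclideanSpace ℝ (Fin 3)) (s₀ z v₀ : EuclideanSpace ℝ (Fin 3))
  (canon : ℤ → EuclideanSpace ℝ (Fin 3) → EuclideanSpace ℝ (Fin 3) × List WalkEntry) (ms : ℤ → EuclideanSpace ℝ (Fin 3))

/-- **One step along the zigzag.**  With the canonical states `canon` and model steps `ms` as in the module docstring: if the
dozen of the site `(m, i, j)` is complete in `X`, then `walkStep` maps the canonical state at `L·barlowPos σ m i j + s₀` to the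
canonical state at `L·(barlowPos σ m i j + ms m) + s₀`, and `barlowPos σ m i j + ms m` is a site of layer `m + 1`. -/
theorem walkStep_canon (hσ : IsHaggSeq σ) (hX₁ : ∀ p ∈ X, ∀ q ∈ X, p ≠ q → 1 ≤ dist p q)
    (hv₀ : v₀ ∈ fccSlots) (hv₀2 : v₀ 2 = Real.sqrt (2 / 3))
    (hcanon₁ : ∀ m t, σ (m - 1) = 1 → canon m t = (t, [⟨L, v₀, 0⟩]))
    (hcanon₂ : ∀ m t, σ (m - 1) = -1 → canon m t =
      (t, [⟨twinFrame L (L (EuclideanSpace.single (2 : Fin 3) (1 : ℝ))),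
            bestCapper (twinFrame L (L (EuclideanSpace.single (2 : Fin 3) (1 : ℝ)))) (L (EuclideanSpace.single (2 : Fin 3) (1 : ℝ))) z,
            L (EuclideanSpace.single (2 : Fin 3) (1 : ℝ))⟩, ⟨L, v₀, 0⟩]))
    (hms₁ : ∀ m, σ m = 1 → ms m = v₀)
    (hms₂ : ∀ m, σ m = -1 → ms m =
      basalMirror (bestCapper (twinFrame L (L (EuclideanSpace.single (2 : Fin 3) (1 : ℝ)))) (L (EuclideanSpace.single (2 : Fin 3) (1 : ℝ))) z))
    {m i j : ℤ}
    (hX : ∀ q ∈ barlowStacking 1 (Real.sqrt (2 / 3)) σ, dist q (barlowPos 1 (Real.sqrt (2 / 3)) σ m i j) ≤ 1 → L q + s₀ ∈ X) :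
    walkStep X z (canon m (L (barlowPos 1 (Real.sqrt (2 / 3)) σ m i j) + s₀)) =
        some (canon (m + 1) (L (barlowPos 1 (Real.sqrt (2 / 3)) σ m i j + ms m) + s₀)) ∧
      barlowPos 1 (Real.sqrt (2 / 3)) σ m i j + ms m ∈ barlowLayer 1 (Real.sqrt (2 / 3)) σ (m + 1) := by
  set e₃ : EuclideanSpace ℝ (Fin 3) := EuclideanSpace.single (2 : Fin 3) (1 : ℝ) with he₃
  set G := twinFrame L (L e₃) with hG
  set q := bestCapper G (L e₃) z with hqdef
  obtain ⟨hq, hq2⟩ : q ∈ fccSlots ∧ q 2 = -Real.sqrt (2 / 3) := bestCapper_nabla_slot L z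
  have hrpos : 0 < Real.sqrt (2 / 3) := Real.sqrt_pos.2 (by norm_num)
  set p₀ := barlowPos 1 (Real.sqrt (2 / 3)) σ m i j with hp₀
  have hm1 : m + 1 - 1 = m := by ring
  -- where the model step lands
  have hlandΔ : σ m = 1 → p₀ + v₀ ∈ barlowLayer 1 (Real.sqrt (2 / 3)) σ (m + 1) := by
    intro hm
    rcases barlow_delta_add_slot_mem σ m i j hm hv₀ (by rw [hv₀2]; exact hrpos.le) with h | h
    · exfalso
      have h2 := apply_two_of_mem_barlowLayer h
      simp only [PiLp.add_apply, barlowPos_apply_two, hv₀2] at h2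
      linarith
    · exact h
  have hlandN : σ m = -1 → p₀ + basalMirror q ∈ barlowLayer 1 (Real.sqrt (2 / 3)) σ (m + 1) := by
    intro hm
    rcases barlow_nabla_add_slot_mem σ m i j hm hq (by rw [hq2]; linarith) with h | h
    · exfalso
      have h2 := apply_two_of_mem_barlowLayer h
      simp only [PiLp.add_apply, barlowPos_apply_two, basalMirror_apply_two', hq2] at h2
      linarith
    · exact h
  have hGq : G q = L (basalMirror q) := by rw [hG, twinFrame_axis_apply]
  rcases hσ m with hm | hm
  · -- the step is `L v₀`
    rw [hms₁ m hm]
    refine ⟨?_, hlandΔ hm⟩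
    have hnext : canon (m + 1) (L (p₀ + v₀) + s₀) = (L p₀ + s₀ + L v₀, [⟨L, v₀, 0⟩]) := by
      rw [hcanon₁ (m + 1) _ (by rw [hm1]; exact hm), map_add]; congr 1; abel
    rw [hnext]
    rcases hσ (m - 1) with hlo | hlo
    · rw [hcanon₁ m _ hlo]; exact walkStep_barlow_cc σ L s₀ m i j hlo hm hX [] 0
    · rw [hcanon₂ m _ hlo]
      have h := walkStep_barlow_hc σ L s₀ m i j hX₁ (z := z) hlo hm hX hq hq2 ⟨L, v₀, 0⟩ []
      exact h
  · -- the step is `G q`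
    rw [hms₂ m hm]
    refine ⟨?_, hlandN hm⟩
    have hnext : canon (m + 1) (L (p₀ + basalMirror q) + s₀) = (L p₀ + s₀ + G q, [⟨G, q, L e₃⟩, ⟨L, v₀, 0⟩]) := by
      rw [hcanon₂ (m + 1) _ (by rw [hm1]; exact hm), map_add, ← hGq]; congr 1; abel
    rw [hnext]
    rcases hσ (m - 1) with hlo | hlo
    · rw [hcanon₁ m _ hlo]; exact walkStep_barlow_ch σ L s₀ m i j hX₁ hlo hm hX hv₀ hv₀2 0
    · rw [hcanon₂ m _ hlo]; exact walkStep_barlow_hh σ L s₀ m i j hlo hm hX [⟨L, v₀, 0⟩] (L e₃)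

/-- **The prefix lemma.**  Let `R` be a region of model space over which the moved plate is complete in `X` (`hR`: the dozen of
every site of `R` is occupied after the motion).  If the first `n` sites `barlowPos σ m i j + Σ_{k'<k} ms (m+k')` (`k < n`) of the
zigzag from `(m, i, j)` lie in `R`, then the walk from the canonical state at site `0` is, after `n` steps, at the canonical
state at site `n`, and site `n` belongs to layer `m + n`. -/
theorem walkRun_canon_prefix (hσ : IsHaggSeq σ) (hX₁ : ∀ p ∈ X, ∀ q ∈ X, p ≠ q → 1 ≤ dist p q)
    (hv₀ : v₀ ∈ fccSlots) (hv₀2 : v₀ 2 = Real.sqrt (2 / 3))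
    (hcanon₁ : ∀ m t, σ (m - 1) = 1 → canon m t = (t, [⟨L, v₀, 0⟩]))
    (hcanon₂ : ∀ m t, σ (m - 1) = -1 → canon m t =
      (t, [⟨twinFrame L (L (EuclideanSpace.single (2 : Fin 3) (1 : ℝ))),
            bestCapper (twinFrame L (L (EuclideanSpace.single (2 : Fin 3) (1 : ℝ)))) (L (EuclideanSpace.single (2 : Fin 3) (1 : ℝ))) z,
            L (EuclideanSpace.single (2 : Fin 3) (1 : ℝ))⟩, ⟨L, v₀, 0⟩]))
    (hms₁ : ∀ m, σ m = 1 → ms m = v₀)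
    (hms₂ : ∀ m, σ m = -1 → ms m =
      basalMirror (bestCapper (twinFrame L (L (EuclideanSpace.single (2 : Fin 3) (1 : ℝ)))) (L (EuclideanSpace.single (2 : Fin 3) (1 : ℝ))) z))
    (R : Set (EuclideanSpace ℝ (Fin 3)))
    (hR : ∀ m i j : ℤ, barlowPos 1 (Real.sqrt (2 / 3)) σ m i j ∈ R →
      ∀ q ∈ barlowStacking 1 (Real.sqrt (2 / 3)) σ, dist q (barlowPos 1 (Real.sqrt (2 / 3)) σ m i j) ≤ 1 → L q + s₀ ∈ X) :
    ∀ (n : ℕ) (m i j : ℤ),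
      (∀ k < n, barlowPos 1 (Real.sqrt (2 / 3)) σ m i j + ∑ k' ∈ Finset.range k, ms (m + k') ∈ R) →
      walkRun X z n (canon m (L (barlowPos 1 (Real.sqrt (2 / 3)) σ m i j) + s₀)) =
          canon (m + n) (L (barlowPos 1 (Real.sqrt (2 / 3)) σ m i j + ∑ k' ∈ Finset.range n, ms (m + k')) + s₀) ∧
        barlowPos 1 (Real.sqrt (2 / 3)) σ m i j + ∑ k' ∈ Finset.range n, ms (m + k') ∈
          barlowLayer 1 (Real.sqrt (2 / 3)) σ (m + n) := by
  intro n
  induction n with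
  | zero =>
    intro m i j _
    refine ⟨by simp, ?_⟩
    simp only [Finset.range_zero, Finset.sum_empty, add_zero, Nat.cast_zero]
    exact ⟨i, j, rfl⟩
  | succ n ih =>
    intro m i j hin
    have h0 : barlowPos 1 (Real.sqrt (2 / 3)) σ m i j ∈ R := by
      have := hin 0 (Nat.succ_pos n); simpa using this
    obtain ⟨hstep, hland⟩ := walkStep_canon σ L s₀ z v₀ canon ms hσ hX₁ hv₀ hv₀2 hcanon₁ hcanon₂ hms₁ hms₂ (hR m i j h0)
    obtain ⟨i', j', hij'⟩ := hland
    -- shift the sums by one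
    have hshift : ∀ k : ℕ, ∑ k' ∈ Finset.range (k + 1), ms (m + k') = ms m + ∑ k' ∈ Finset.range k, ms (m + 1 + k') := by
      intro k
      rw [Finset.sum_range_succ', Nat.cast_zero, add_zero, add_comm]
      congr 1
      refine Finset.sum_congr rfl fun k' _ => ?_
      push_cast; ring_nf
    have hin' : ∀ k < n, barlowPos 1 (Real.sqrt (2 / 3)) σ (m + 1) i' j' + ∑ k' ∈ Finset.range k, ms (m + 1 + k') ∈ R := by
      intro k hk
      have h := hin (k + 1) (Nat.succ_lt_succ hk)
      rw [hshift, ← add_assoc, hij'] at h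
      exact h
    obtain ⟨ih1, ih2⟩ := ih (m + 1) i' j' hin'
    have hpos : barlowPos 1 (Real.sqrt (2 / 3)) σ m i j + ∑ k' ∈ Finset.range (n + 1), ms (m + k') =
        barlowPos 1 (Real.sqrt (2 / 3)) σ (m + 1) i' j' + ∑ k' ∈ Finset.range n, ms (m + 1 + k') := by
      rw [hshift, ← add_assoc, hij']
    have hmn : m + ((n + 1 : ℕ) : ℤ) = m + 1 + (n : ℤ) := by push_cast; ring
    rw [walkRun_succ_of_some X z n hstep, hij', hpos, hmn]
    exact ⟨ih1, ih2⟩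

end Moved

end Summit.Ventures.Crystal3D.Theorems

end
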